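import Summits.SmoothPoincare4.SmoothPoincare4.Theses.DottedCircleRasmussen
import Literature.Topology.FourManifolds.ClosedBallProofs

/-!
# SmoothPoincare4 / DottedCircleRasmussen — transport support `DcrTransport`

Settles item stmt-SmoothPoincare4-16119 (support `DcrTransport` of route DottedCircleRasmussen):
an embedding/disc datum `(e, f)` for `(k, K₀)` in a smooth 4-manifold `M` is carried to one in `S⁴`
by any diffeomorphism `Φ : M ≃ₘ S⁴`, i.e. all six clauses of the datum are stable under
postcomposition with `Φ`:

* `Φ ∘ e` is again a smooth embedding (`Manifold.IsSmoothEmbedding.diffeomorph_comp`,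
  `Literature/Topology/FourManifolds/ClosedBallProofs.lean`, filling Mathlib's `proof_wanted`);
* `Φ ∘ f` is `C^∞` (`ContMDiff.comp`);
* `Φ ∘ f` is injective on the closed unit disc (`Φ` is injective);
* `mfderiv (Φ ∘ f) x = mfderiv Φ (f x) ∘ mfderiv f x` (chain rule) is injective, the first factor
  being a continuous linear equivalence (`Diffeomorph.mfderivToContinuousLinearEquiv`);
* the open disc stays disjoint from the image of the model handlebody `D_k` (injectivity of `Φ`);
* the boundary identity `f t = e (K t)` is preserved (`congrArg`).

Routine transport; no named facts are used. Sources: Lee, *Introduction to Smooth Manifolds*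
(2013), Ch. 4–5 (immersions/embeddings and diffeomorphisms). [folklore]
-/

namespace Summit.SmoothPoincare4.SmoothPoincare4.Theorems

open scoped Manifold ContDiff
open Summit.SmoothPoincare4.SmoothPoincare4.Theses.DottedCircleRasmussen

/-- Settles stmt-SmoothPoincare4-16119: the transport support `DcrTransport` of route
DottedCircleRasmussen — an embedding/disc datum `(e, f)` for `(k, K₀)` in `M` is carried by a
diffeomorphism `Φ : M ≃ₘ S⁴` to the datum `(Φ ∘ e, Φ ∘ f)` in `S⁴`. Proof: unfold and check the
six clauses (smooth embedding after a diffeomorphism, `ContMDiff.comp`, injectivity of `Φ`, chain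
rule with the invertible `mfderiv Φ`, injectivity of `Φ` on images, `congrArg Φ`). [folklore] -/
theorem DcrTransport_proof :
    Summit.SmoothPoincare4.SmoothPoincare4.Theses.DottedCircleRasmussen.DcrTransport := by
  unfold DcrTransport
  intro M _ _ _ _ _ Φ k e K f h
  obtain ⟨he, hf, hinj, hmf, hdisj, hbd⟩ := h
  have hn : ((⊤ : ℕ∞) : WithTop ℕ∞) ≠ 0 := by simp
  refine ⟨he.diffeomorph_comp Φ, Φ.contMDiff.comp hf, (EquivLike.injective Φ).comp_injOn hinj,
    ?_, ?_, ?_⟩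
  · intro x hx
    rw [mfderiv_comp x (Φ.mdifferentiable hn (f x)) (hf.mdifferentiableAt hn)]
    have hΦ : Function.Injective (mfderiv (𝓡 4) (𝓡 4) Φ (f x)) :=
      (Φ.mfderivToContinuousLinearEquiv hn (f x)).injective
    exact hΦ.comp (hmf x hx)
  · intro x hx hmem
    obtain ⟨y, hy, hyx⟩ := hmem
    exact hdisj x hx ⟨y, hy, EquivLike.injective Φ hyx⟩
  · intro t
    exact congrArg Φ (hbd t)

end Summit.SmoothPoincare4.SmoothPoincare4.Theorems
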